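import Literature.Computability.Cryptography.ClassBQP
import Literature.Computability.QuantumComplexity.BQPMajorityAmplification
import HarnessLib

/-!
# Error reduction for `BQP`: `BQPWith cliffordT ε = BQP` for `0 < ε < 1/2` (discharge)

Sibling proof file of `ClassBQP.lean` for the named fact
`Literature.Computability.Cryptography.BQP_eq_BQPWith` (D-0014: the fact stays a `def`; this file
lands `BQP_eq_BQPWith_holds`).

The printed source is Bernstein–Vazirani, *Quantum complexity theory*, SIAM J. Comput. 26 (1997),
§8.2, Thm. 8.5, p. 1452 (a `BQTime(T(n))` language is accepted with probability `1 - ε` in time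
`c T(n)`, `c` polynomial in `log 1/ε`), whose proof is Bennett–Bernstein–Brassard–Vazirani,
*Strengths and weaknesses of quantum computing*, SIAM J. Comput. 26 (1997), Thm. 4.13: "We will build
a machine that runs `k` independent copies of `M` and then takes the vote of the `k` answers … this is
just like taking the majority of `k` independent coin flips each with probability at least `2/3` of
heads." In the tree's uniform Clifford+T circuit model (`Cryptography/QuantumCircuit.lean`) the
`k` copies and the vote are the composite family of
`QuantumComplexity/BQPMajorityAmplification.lean` (`exists_majority_amplified`: the `K`-copy family
`PostBQPAmp.family` of `PostBQPAmplification.lean` followed by the classical polynomial-time majority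
read-out through the classical wrap `CWrap.family`, with the weighted Chebyshev estimate of
`Complexity/MajorityVoteWeighted.lean`, error `≤ 1/(4Kη²)` for advantage `η`).

Contents: `BQPWith_subset_BQPWith_of_lt_half` (any error `< 1/2` is reduced to any `δ > 0`:
`η = 1/2 - ε`, `K = ⌈1/(4δη²)⌉ + 1` copies) and the discharge `BQP_eq_BQPWith_holds` (both
inclusions, by amplification or by monotonicity `BQPWith_mono` according to the position of `ε`
relative to `1/3`). As usual (Watrous 2009, §III.1) the statement is given for every constant error
bound in `(0, 1/2)`, the source's `2/3` being one instance.

## References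

* E. Bernstein, U. Vazirani, *Quantum complexity theory*, SIAM J. Comput. 26 (1997) 1411–1473,
  §8.1 Def. 8.1 (acceptance with probability `p`, BQP), §8.2 Thm. 8.5 (p. 1452) [BernsteinVazirani1997].
* C. H. Bennett, E. Bernstein, G. Brassard, U. Vazirani, *Strengths and weaknesses of quantum
  computing*, SIAM J. Comput. 26 (1997) 1510–1523, Thm. 4.13 (boosting by majority vote)
  [BennettBernsteinBrassardVazirani1997].
* J. Watrous, *Quantum computational complexity*, Encyclopedia of Complexity and Systems Science
  (2009), §III.1 (error reduction for BQP) [Watrous2009].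
-/

noncomputable section

namespace Literature.Computability.Cryptography

open _root_.Computability Complexity QuantumComplexity

/-- **Error reduction for uniform quantum circuit families**: every language decided with some
two-sided error `ε < 1/2` by a polynomial-time uniform, oracle-free Clifford+T family is decided with
any prescribed error `δ > 0` by such a family — `K = ⌈1/(4δη²)⌉ + 1` parallel copies and a majority
vote, `η = 1/2 - ε` (Bennett–Bernstein–Brassard–Vazirani 1997, Thm. 4.13: "`k = b log 1/ε`" copies
suffice; the polynomial dependence on `1/δ` of the Chebyshev count used here is immaterial for
constant `δ`). [cite: BennettBernsteinBrassardVazirani1997, Thm. 4.13] -/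
theorem BQPWith_subset_BQPWith_of_lt_half {ε δ : ℝ} (hε : ε < 1 / 2) (hδ : 0 < δ) :
    BQPWith cliffordT ε ⊆ BQPWith cliffordT δ := by
  rintro L ⟨F, hF, hU, hL⟩
  set η : ℝ := 1 / 2 - ε with hη
  have hηpos : 0 < η := by rw [hη]; linarith
  set K : ℕ := ⌈1 / (4 * δ * η ^ 2)⌉₊ + 1 with hK
  have hKpos : 0 < K := Nat.succ_pos _
  have hKge : 1 / (4 * δ * η ^ 2) ≤ K := by
    rw [hK, Nat.cast_add, Nat.cast_one]
    exact (Nat.le_ceil _).trans (le_add_of_nonneg_right zero_le_one)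
  -- the error of the amplified family is at most `δ`
  have herr : 1 / (4 * K * η ^ 2) ≤ δ := by
    have hKr : (0 : ℝ) < K := by exact_mod_cast hKpos
    rw [div_le_iff₀ (by positivity)]
    rw [div_le_iff₀ (by positivity)] at hKge
    nlinarith [hKge, hKr, sq_pos_of_pos hηpos]
  obtain ⟨F', hF', hU', hF'x⟩ := exists_majority_amplified hF hU hKpos hηpos
  refine ⟨F', hF', hU', fun x => ⟨fun hx => ?_, fun hx => ?_⟩⟩
  · have h1 : 1 / 2 + η ≤ F.acceptProbOn 0 x := by
      have := (hL x).1 hx; rw [hη]; linarith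
    exact le_trans (by linarith) ((hF'x x).1 h1)
  · have h1 : F.acceptProbOn 0 x ≤ 1 / 2 - η := by
      have := (hL x).2 hx; rw [hη]; linarith
    exact ((hF'x x).2 h1).trans herr

/-- **Error reduction for BQP** (Bernstein–Vazirani 1997, Thm. 8.5; Bennett–Bernstein–Brassard–
Vazirani 1997, Thm. 4.13) — discharge of the named fact `BQP_eq_BQPWith`: for every constant
`0 < ε < 1/2`, the languages decided with two-sided error `ε` by polynomial-time uniform Clifford+T
circuit families are exactly `BQP` (error `1/3`). Each inclusion is either monotonicity of
`BQPWith` in the error bound or majority-vote amplification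
(`BQPWith_subset_BQPWith_of_lt_half`). [cite: BernsteinVazirani1997, §8.2 Thm. 8.5] -/
theorem BQP_eq_BQPWith_holds : BQP_eq_BQPWith := by
  intro ε hε hε'
  change BQPWith cliffordT ε = BQPWith cliffordT (1 / 3)
  apply Set.Subset.antisymm
  · rcases le_or_gt ε (1 / 3) with h | h
    · exact BQPWith_mono h
    · exact BQPWith_subset_BQPWith_of_lt_half hε' (by norm_num)
  · rcases le_or_gt (1 / 3 : ℝ) ε with h | h
    · exact BQPWith_mono h
    · exact BQPWith_subset_BQPWith_of_lt_half (by norm_num) hε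

end Literature.Computability.Cryptography

end
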